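import Literature.Analysis.FluidPDE.KatoLocalL3Exists
import Literature.Analysis.FluidPDE.MildL3SmoothOfKNSS
import Literature.Analysis.FluidPDE.NSBoundedMildOseenAssembly
import Literature.Analysis.FluidPDE.ClassicalSolutionGlue
import HarnessLib

/-!
# Smoothing of mild `C([0,T); L³)` solutions: `mild_L3_smooth` from the KNSS local theory

Analysis/FluidPDE proof file (no definitions, no named facts) assembling the discharge of the
named fact `Literature.Analysis.FluidPDE.mild_L3_smooth` (`NSLerayHopfSereginProofs.lean`;
Giga 1986, Thm. 4 with the Remark on p. 202; Lemarié-Rieusset 2016, Thm. 7.5 with Thm. 9.12 and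
proof of Thm. 15.1 (A); Escauriaza–Seregin–Šverák 2003, §1). By `mild_L3_smooth_of_facts`
(`MildL3Smooth.lean`) the fact follows from three named facts:

* `mild_L3_restart` — **discharged** (`mild_L3_restart_holds`, `MildL3RestartAveraging.lean`);
* `kato_local_L3` — **discharged** (`kato_local_L3_holds`, `KatoLocalL3Exists.lean`, on the
  Picard construction `KatoPicard.lean`, `KatoMildContinuity.lean`, `KatoL3FixedPointClass.lean`);
* `classical_of_bounded_mild_L3` — **reduced** in the tree to the KNSS smoothing fact (P)
  `knss2009_smoothing ℝ³` (`classical_of_bounded_mild_L3_of_knss2009_smoothing`,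
  `MildL3SmoothOfKNSS.lean`), itself reduced to the local theory (L)
  `knss2009_local_smoothing ℝ³` (`knss2009_smoothing_three_of_local`,
  `NSBoundedMildOseenAssembly.lean`; Koch–Nadirashvili–Seregin–Šverák 2009, Prop. 4.1 in its
  quantitative short-time form).

Hence the dependency record of `mild_L3_smooth` is now the **single** named fact (L):
`mild_L3_smooth_of_local : knss2009_local_smoothing ℝ³ → mild_L3_smooth`
(and `mild_L3_smooth_of_smoothing` from (P)). Two gluing tools for classical solutions on open
time windows, companions of the tree's `IsClassicalNSSolutionOn.exists_glue_Ioc` and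
`IsClassicalNSSolutionOn.translate_Ico`, are recorded alongside
(`IsClassicalNSSolutionOn.exists_glue_Ioo`, `IsClassicalNSSolutionOn.translate_back_Ioo`).

## Mathlib / tree search

Tree (`lean search 'mild_L3_smooth|classical_of_bounded_mild_L3|knss2009'`):
`mild_L3_smooth_of_facts` (`MildL3Smooth.lean`), `mild_L3_restart_holds`, `kato_local_L3_holds`,
`classical_of_bounded_mild_L3_of_knss2009_smoothing`, `knss2009_smoothing_three_of_local`; no
`mild_L3_smooth_holds`/`_of_local` existed. Mathlib: `contDiffOn_of_locally_contDiffOn`,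
`derivWithin_of_mem_nhds`, `Filter.EventuallyEq.deriv_eq`.

## References

* Y. Giga, *Solutions for semilinear parabolic equations in `L^p` and regularity of weak
  solutions of the Navier–Stokes system*, J. Differential Equations 62 (1986) 186–212, Thm. 4 and
  Remark p. 202. [Giga1986]
* G. Koch, N. Nadirashvili, G. Seregin, V. Šverák, *Liouville theorems for the Navier–Stokes
  equations and applications*, Acta Math. 203 (2009) 83–105 = arXiv:0709.3599, §4, Prop. 4.1.
  [KochNadirashviliSereginSverak2009]
* P. G. Lemarié-Rieusset, *The Navier–Stokes Problem in the 21st Century*, CRC Press 2016,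
  Thm. 7.5, Thm. 9.12, proof of Thm. 15.1 (A) (PDF p. 565). [LemarieRieusset2016]
-/

noncomputable section

open MeasureTheory TopologicalSpace Set Function Filter Metric
open _root_.Topology
open scoped ENNReal NNReal RealInnerProductSpace InnerProductSpace

namespace Literature.Analysis.FluidPDE

/-! ### Gluing classical solutions on open final segments -/

section Glue

variable {E : Type*} [NormedAddCommGroup E] [InnerProductSpace ℝ E] [FiniteDimensional ℝ E]
  [MeasurableSpace E] [BorelSpace E] {ν : ℝ}

omit [MeasurableSpace E] [BorelSpace E] in
/-- **Gluing classical solutions on nested open final segments.** Let `(V n, P n)` be classical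
solutions (same `ν`, same force) on `(s n, T)`, `0 < s n`, with `s n` becoming arbitrarily
small, whose velocities agree on the common part of any two of the time sets. Then there is a
classical solution `(v, p)` on `(0, T)` with `v = V n` on `(s n, T)` for every `n` (the
normalised pressures `P n(t) - P n(t, 0)` agree, `pressure_sub_apply_zero_eq_of_eventuallyEq`;
smoothness is local; all time sets are open). The tree's `exists_glue_Ioc` is the version for
the segments `(s n, T]`. [folklore] -/
theorem IsClassicalNSSolutionOn.exists_glue_Ioo {T : ℝ} {f : ℝ → E → E} {s : ℕ → ℝ}
    {V : ℕ → ℝ → E → E} {P : ℕ → ℝ → E → ℝ} (hs0 : ∀ n, 0 < s n)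
    (hs : ∀ t, 0 < t → ∃ n, s n < t)
    (hV : ∀ n, IsClassicalNSSolutionOn (Ioo (s n) T) ν f (V n) (P n))
    (hagree : ∀ m n, ∀ t ∈ Ioo (max (s m) (s n)) T, V m t = V n t) :
    ∃ (v : ℝ → E → E) (p : ℝ → E → ℝ), IsClassicalNSSolutionOn (Ioo 0 T) ν f v p ∧
      ∀ n, ∀ t ∈ Ioo (s n) T, v t = V n t := by
  classical
  -- the index of a piece containing `t`
  set N : ℝ → ℕ := fun t => if h : ∃ n, s n < t then Nat.find h else 0 with hN_def
  have hN : ∀ t, 0 < t → s (N t) < t := by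
    intro t ht
    have h := hs t ht
    simp only [hN_def, dif_pos h]
    exact Nat.find_spec h
  set v : ℝ → E → E := fun t => V (N t) t with hv_def
  set p : ℝ → E → ℝ := fun t x => P (N t) t x - P (N t) t 0 with hp_def
  have hnhds : ∀ n, ∀ t ∈ Ioo (s n) T, Ioo (s n) T ∈ 𝓝 t := fun n t ht => Ioo_mem_nhds ht.1 ht.2
  have hev : ∀ m n, ∀ t ∈ Ioo (max (s m) (s n)) T, ∀ᶠ τ in 𝓝 t, V m τ = V n τ := by
    intro m n t ht
    filter_upwards [Ioo_mem_nhds ht.1 ht.2] with τ hτ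
    exact hagree m n τ hτ
  -- on the piece `(s n, T)` the glued fields are those of the piece `n`
  have hvn : ∀ n, ∀ t ∈ Ioo (s n) T, v t = V n t := by
    intro n t ht
    have ht0 : 0 < t := (hs0 n).trans ht.1
    exact hagree (N t) n t ⟨max_lt (hN t ht0) ht.1, ht.2⟩
  have hpn : ∀ n, ∀ t ∈ Ioo (s n) T, ∀ x, p t x = P n t x - P n t 0 := by
    intro n t ht x
    have ht0 : 0 < t := (hs0 n).trans ht.1
    have hm : t ∈ Ioo (s (N t)) T := ⟨hN t ht0, ht.2⟩
    exact (hV (N t)).pressure_sub_apply_zero_eq_of_eventuallyEq (hV n) (hnhds _ t hm)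
      (hnhds n t ht) (hev (N t) n t ⟨max_lt hm.1 ht.1, ht.2⟩) x
  -- the time derivative within `(0, T)` is that within the piece
  have hdt0 : ∀ n, ∀ t ∈ Ioo (s n) T, ∀ x,
      timeDerivWithin (Ioo 0 T) v t x = timeDerivWithin (Ioo (s n) T) (V n) t x := by
    intro n t ht x
    have ht0 : 0 < t := (hs0 n).trans ht.1
    simp only [timeDerivWithin_apply]
    rw [derivWithin_of_mem_nhds (Ioo_mem_nhds ht0 ht.2), derivWithin_of_mem_nhds (hnhds n t ht)]
    refine Filter.EventuallyEq.deriv_eq ?_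
    filter_upwards [hnhds n t ht] with τ hτ
    exact congrFun (hvn n τ hτ) x
  -- openness of the pieces
  have hpiece : ∀ n, Ioo 0 T ×ˢ (univ : Set E) ∩ Ioi (s n) ×ˢ univ = Ioo (s n) T ×ˢ univ := by
    intro n
    ext ⟨t, x⟩
    simp only [mem_inter_iff, mem_prod, mem_Ioo, mem_univ, and_true, mem_Ioi]
    constructor
    · rintro ⟨⟨-, h2⟩, h3⟩; exact ⟨h3, h2⟩
    · rintro ⟨h1, h2⟩; exact ⟨⟨(hs0 n).trans h1, h2⟩, h1⟩
  have hsmooth : ∀ (w : ℝ → E → ℝ) (W : ℕ → ℝ → E → ℝ),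
      (∀ n, IsSmoothSpaceTimeOn (Ioo (s n) T) (W n)) →
      (∀ n, ∀ t ∈ Ioo (s n) T, ∀ x, w t x = W n t x) → IsSmoothSpaceTimeOn (Ioo 0 T) w := by
    intro w W hW hwW
    refine contDiffOn_of_locally_contDiffOn fun z hz => ?_
    obtain ⟨n, hn⟩ := hs z.1 hz.1.1
    refine ⟨Ioi (s n) ×ˢ univ, isOpen_Ioi.prod isOpen_univ, ⟨hn, mem_univ _⟩, ?_⟩
    rw [hpiece n]
    exact (hW n).congr fun z' hz' => hwW n z'.1 hz'.1 z'.2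
  have hsmoothE : ∀ (w : ℝ → E → E) (W : ℕ → ℝ → E → E),
      (∀ n, IsSmoothSpaceTimeOn (Ioo (s n) T) (W n)) →
      (∀ n, ∀ t ∈ Ioo (s n) T, w t = W n t) → IsSmoothSpaceTimeOn (Ioo 0 T) w := by
    intro w W hW hwW
    refine contDiffOn_of_locally_contDiffOn fun z hz => ?_
    obtain ⟨n, hn⟩ := hs z.1 hz.1.1
    refine ⟨Ioi (s n) ×ˢ univ, isOpen_Ioi.prod isOpen_univ, ⟨hn, mem_univ _⟩, ?_⟩
    rw [hpiece n]
    exact (hW n).congr fun z' hz' => by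
      show w z'.1 z'.2 = W n z'.1 z'.2
      rw [hwW n z'.1 hz'.1]
  refine ⟨v, p, ⟨?_, ?_, ?_, ?_⟩, hvn⟩
  · exact hsmoothE v V (fun n => (hV n).smooth_velocity) hvn
  · exact hsmooth p (fun n t x => P n t x - P n t 0)
      (fun n => (hV n).smooth_pressure.sub_apply_zero) hpn
  · intro t ht x
    obtain ⟨n, hn⟩ := hs t ht.1
    have htn : t ∈ Ioo (s n) T := ⟨hn, ht.2⟩
    have hgrad : gradient (p t) x = gradient (P n t) x := by
      rw [show p t = fun y => P n t y - P n t 0 from funext (hpn n t htn), gradient_sub_const]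
    rw [hdt0 n t htn x, hvn n t htn, hgrad]
    exact (hV n).momentum t htn x
  · intro t ht
    obtain ⟨n, hn⟩ := hs t ht.1
    rw [hvn n t ⟨hn, ht.2⟩]
    exact (hV n).divFree t ⟨hn, ht.2⟩

omit [MeasurableSpace E] [BorelSpace E] in
/-- **Time translation of a classical solution on an open window**: a classical solution of
the unforced system on `(0, T')` translated back by `s` is a classical solution on
`(s, s + T')`. [folklore] -/
theorem IsClassicalNSSolutionOn.translate_back_Ioo {T' s : ℝ} {u : ℝ → E → E} {p : ℝ → E → ℝ}
    (h : IsClassicalNSSolutionOn (Ioo 0 T') ν 0 u p) :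
    IsClassicalNSSolutionOn (Ioo s (s + T')) ν 0 (fun t => u (t - s)) (fun t => p (t - s)) := by
  have h1 := h.comp_add_right (-s)
  have hset : (fun t : ℝ => t + -s) ⁻¹' Ioo 0 T' = Ioo s (s + T') := by
    ext t
    simp only [mem_preimage, mem_Ioo]
    constructor
    · rintro ⟨h1, h2⟩; exact ⟨by linarith, by linarith⟩
    · rintro ⟨h1, h2⟩; exact ⟨by linarith, by linarith⟩
  rw [hset] at h1
  have hf : (fun t : ℝ => (0 : ℝ → E → E) (t + -s)) = 0 := by funext t; rfl
  have hu' : (fun t : ℝ => u (t + -s)) = fun t => u (t - s) := by funext t; rw [← sub_eq_add_neg]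
  have hp' : (fun t : ℝ => p (t + -s)) = fun t => p (t - s) := by funext t; rw [← sub_eq_add_neg]
  rw [hf, hu', hp'] at h1
  exact h1

end Glue

/-! ### `mild_L3_smooth` from (P), and from (L) alone -/

section Assembly

/-- **`mild_L3_smooth` from the KNSS smoothing fact (P)** (`knss2009_smoothing ℝ³`, KNSS 2009,
Prop. 4.1): `mild_L3_smooth_of_facts` fed with the discharged `mild_L3_restart_holds`,
`kato_local_L3_holds` and the tree's reduction
`classical_of_bounded_mild_L3_of_knss2009_smoothing` (Giga 1986, Thm. 4 and Remark p. 202: the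
mild `C([0,T₀); L³)` solution is a classical smooth solution on `(0, T₀)`). [cite: Giga1986, Thm. 4, Remark (p. 202)] -/
theorem mild_L3_smooth_of_smoothing (hP : knss2009_smoothing (EuclideanSpace ℝ (Fin 3))) :
    mild_L3_smooth :=
  mild_L3_smooth_of_facts mild_L3_restart_holds kato_local_L3_holds
    (classical_of_bounded_mild_L3_of_knss2009_smoothing hP)

/-- **`mild_L3_smooth` from the KNSS local theory (L) alone** (`knss2009_local_smoothing ℝ³`,
KNSS 2009, Prop. 4.1 in its quantitative short-time form), through
`knss2009_smoothing_three_of_local`. [cite: KochNadirashviliSereginSverak2009, Prop. 4.1 (arXiv:0709.3599 p. 8)] -/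
theorem mild_L3_smooth_of_local (hL : knss2009_local_smoothing (EuclideanSpace ℝ (Fin 3))) :
    mild_L3_smooth :=
  mild_L3_smooth_of_smoothing (knss2009_smoothing_three_of_local hL)

/-- **Seregin's `L³` criterion re-routed to (L)**: with `mild_L3_smooth` reduced to the KNSS
local theory, the tree's form `seregin_L3_blowup` follows from Lemarié-Rieusset's Thm. 15.5
(`seregin_L3_blowup_mild`) and (L), through `seregin_L3_blowup_of_facts`.
[cite: LemarieRieusset2016, Thm. 15.5] [cite: Seregin2012CMP, Thm. 1.1] -/
theorem seregin_L3_blowup_of_mild_local (h15 : seregin_L3_blowup_mild)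
    (hL : knss2009_local_smoothing (EuclideanSpace ℝ (Fin 3))) : seregin_L3_blowup :=
  seregin_L3_blowup_of_facts h15 (mild_L3_smooth_of_local hL)

end Assembly

end Literature.Analysis.FluidPDE

end
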